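import Literature.MathematicalPhysics.QuantumFieldTheory.Balaban1983to89.B9Thm39FacesAtLettersRC

/-!
# `Balaban1983to89.B9Thm39FacesAtLettersRCPar` — CASCADE-K PIECE (director-ym №383), K2: ROWS 15 ∧ 16 (THEOREM 3.9 AND THE KERNEL SUM OF (3.48)⁻¹) AT A
# LETTER FAMILY WITH THE AVERAGING TRANSPORTER OF `L = Q′G′²Q′*` EXPLICIT — the re-press ONCE of `B9Thm39ReadingFaithful.reading_le_of_letters_F`,
# `B9Thm39PureGaugeClassAtLettersR.kerReadsLeVia_opsYOfLettersR_F` and `B9Thm39FacesAtLettersRC.t39_hksum_of_pins_opsYOfLetters_FRC ∕ …_oneCube_…_FRC`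

T. Bałaban, *Propagators for lattice gauge theories in a background field*, Commun. Math. Phys. **99** (1985) 389–434 [`Balaban1985BackgroundPropagators`],
Thm 3.9 (3.98)–(3.99) pp. 412–413, Thm 3.2 (3.48) p. 398, (3.95)–(3.96) p. 411, (3.25) p. 395, (3.19) p. 393 (the averaging transporter inside `Q′`), (3.40)
p. 397 (the Hölder transporter); T. Bałaban, *Propagators and renormalization transformations for lattice gauge theories. II*, Commun. Math. Phys. **96**
(1984) 223–250 [`Balaban1984PropagatorsII`], Lemma 2.1 (2.61) p. 234, (2.45) p. 231, (2.51) p. 232, p. 248.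

statement-level bookkeeping over published theorems with citation tags; proofs where landed; nothing here is a claim about the Yang–Mills mass gap

WHY THIS FILE (cell context).  The rows-15∕16 readers of the N06 certificate identify the (3.48) kernel of the letter record `𝔏` with the inverse of the
one-cube letter `L = Q′G′²Q′*` of (3.95) through the pin `hC : (𝔏 x).C = CY x (𝔏 x).parS (𝔏 x).Gp` and the one-cube ops
`oneCubeOps39YFR … 𝔏 …` (`L := L39 x (𝔏 x).parS (𝔏 x).Gp`): the letter record's field `parS` is read as the AVERAGING transporter inside `Q′`.  At the knit
letters of record (`Node00.OpsYRecordV11H.lettersYOfRecordV11KH`, node00-def-Y g32; dag-n06-c FLAG K1-PAR) `parS := parSymY` is print's (3.40) HÖLDER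
transporter while `C := CY (parKnitY) (GpY parKnitY)` carries print's knit averaging transporter — the pin `hC` is FALSE there (dag-n06-d g25, located).
THIS FILE re-presses the three readers ONCE with the averaging transporter a PARAMETER `parA : ∀ x, SiteParY _ x.toKIdx` (`hC : (𝔏 x).C = CY x (parA x) (𝔏 x).Gp`,
`hL : (𝔬39 x).L = L39 x (parA x) (𝔏 x).Gp`, one-cube ops `oneCubeOps39 … (L39 x (parA x) (𝔏 x).Gp)`); proofs verbatim (n06-i's
`norm_CY_deltaY_le_of_inverse x par Gp …` was already parametric).  At `parA := fun x => (𝔏 x).parS` they ARE the originals (same terms).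

WHAT IS IN THE FILE (0 `def`, 0 `sorry`; standard axioms).
* `reading_le_of_letters_F_par` — the carrier-kernel reading `|C⁻¹.ker U y y′| ≤ (c_R·|κ39|)·vol⁻¹·blockKer …` for `𝔏.C = CY x parA 𝔏.Gp`, `𝔬.L = L39 x parA 𝔏.Gp`.
* `kerReadsLeVia_opsYOfLettersR_F_par` — `KerReadsLeVia (𝔬39 x) (siteKernelR R₁ R₂ (opsYOfLetters … 𝔏 𝔈 x).Cinv) …` under the two parametric pins.
* ★★ `t39_hksum_of_pins_opsYOfLetters_FRC_par` — rows 15 ∧ 16 (`B9.Thm39Printed` ∧ `B9.RWKernelSumYields` over `bg9YR … R₁ R₂`) from the displayed one-cube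
  schemas, the two parametric pins and the `𝔈`-pin `hEK39`, generic `(R₁, R₂, c)`.
* ★★★ `t39_hksum_oneCube_opsYOfLetters_FRC_par` — the same from ONE display `h348 : … → Conv348Blk (oneCubeOps39 (geo9Y x) (bg9YR … x) (blk39F _ x.toKIdx (bI x))
  (L39 x.toKIdx (parA x) (𝔏 x).Gp)) B₀ δ₀ U` (the knit certificate's rows-15∕16 binder `h348` and `𝔈`-pin `hEK39` shapes, `parA := parKnitY`).

HONEST SCOPE.  Composition of landed theorems and quantifier bookkeeping; the display `h348`, the schemas and the pins stay hypotheses; nothing of [B9] is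
asserted beyond what the inputs say.  COUNT-NEUTRAL; N06 NOT discharged; one finite lattice programme at fixed `ε` — nothing continuum ∕ OS ∕ mass-gap ∕ Clay.
Cell `pub-ymgap` (HUMAN RULING D-0062), Track A node N06 [B9], seat `pub-ymgap-dag-n06-d` (g25), 2026-08-30.

RELATED IN THE TREE, NOT DUPLICATED: `B9Thm39ReadingFaithful` (`reading_le_of_letters_F`, `abs_entry_le_blockKer`, the representatives `repSite39F ∕ rep39F`),
`B9Thm39PureGaugeClassAtLettersR` (`oneCubeOps39YFR`, `kerReadsLeVia_opsYOfLettersR_F`), `B9Thm39FacesAtLettersRC` (the `parS`-pinned rows), `B9Thm39WholeBlkViaDatum`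
(`thm39_and_kernelSum_of_pin_rowConst261BlkViaDatum`), `B9Thm39OneCubeReadingAtLettersY` (`oneCubeOps39`, its static ∕ locality ∕ schema lemmas) — all USED BY NAME.
-/

noncomputable section

namespace Literature.MathematicalPhysics.QuantumFieldTheory.Balaban1983to89.B9Thm39FacesAtLettersRCPar

open Literature.MathematicalPhysics.QuantumFieldTheory.Balaban1983to89
open Finset B6RandomWalk B9Thm39Whole B9Thm39WholeBlk B9Thm39WholeBlkVia B9Thm39WholeBlkViaDatum B9Thm39ReadingCoords B9Thm39ReadingAtLetters
  B9Thm39ReadingFaithful B9Thm39Thm311AtLettersR B9Thm39OneCubeReadingAtLettersY B9Thm39PureGaugeClassAtLettersR Node00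
open B6KLevelCensusIndexV1 B6Geom246MultiLevelBox B6Geom246MultiLevelTorus B6Ineq2142KLevelV1 B6GlobalChartV1 B9PinMembersKLevelV1
  B9PinCarriersKLevelV1 B9PinGeometryKLevelV1 B7Prop2SpecialUnitary B9Ineq349SiteFromConv348 B9BackgroundsKLevelV1R B9BackgroundsKLevelV1P
  B9GeoLemma21KLevelV1
open B9Thm34Inv

/-! ## §1 The carrier-kernel reading with the averaging transporter explicit -/

section Reading

variable {𝔸 : Type} [NormedRing 𝔸] [NormedAlgebra ℂ 𝔸] [CompleteSpace 𝔸] [FiniteDimensional ℂ 𝔸]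
variable {d ℓ : ℕ} {hd : 1 ≤ d + 1} {hL : Odd (ℓ + 1) ∧ 1 < ℓ + 1} {b₀ b₁ : ℝ} {Mstar : ℕ} {G : Subgroup 𝔸ˣ} {ι κ' : Type}
variable [∀ x : MemberY d ℓ hd hL b₀ b₁ Mstar, DecidableEq (geo9Y x).Site]

/-- ★★ **`reading_le_of_letters_F` WITH THE AVERAGING TRANSPORTER A PARAMETER**: for letters `𝔏` with `𝔏.C = CY … parA 𝔏.Gp`, carrier letters `𝔬` over `X39` with
`𝔬.blk = blk39F bI` and `𝔬.L = L39 parA 𝔏.Gp`, at every `U` where `𝔬.L U` has a two-sided inverse `T`: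
`|Cinv.ker U y y′| ≤ (cR39·|κ39|)·((L^{j(y′)}η)^{d+1})⁻¹·blockKer 𝔬.blk T (πF y) (πF y′)` — n06-i∕n06-j's proof verbatim (`norm_CY_deltaY_le_of_inverse x parA 𝔏.Gp`).
[cite: Balaban1985BackgroundPropagators, Thm 3.2 (3.48) p.398 + (3.25) p.395 + (3.96) p.411 + (3.19) p.393; Balaban1984PropagatorsII, (2.51) p.232 + p.248] -/
theorem reading_le_of_letters_F_par (x : MemberY d ℓ hd hL b₀ b₁ Mstar) (𝔏 : CovLettersY 𝔸 x) (𝔈 : ExpLettersY 𝔸 G x) (parA : SiteParY 𝔸 x.toKIdx)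
    (hC : 𝔏.C = CY x.toKIdx parA 𝔏.Gp) {bI : FBondY x.toKIdx → IBondY x.toKIdx}
    (𝔬 : Ops39Blk (geo9Y x) (bg9Y 𝔸 G x) (X39 𝔸 x.toKIdx) ι κ')
    (hblk : 𝔬.blk = blk39F 𝔸 x.toKIdx bI) (hL39 : 𝔬.L = L39 x.toKIdx parA 𝔏.Gp)
    (U : (bg9Y 𝔸 G x).Cfg) (T : Module.End ℝ (X39 𝔸 x.toKIdx → ℝ)) (hTL : T * 𝔬.L U = 1) (hLT : 𝔬.L U * T = 1)
    (y y' : (geo9Y x).Site) :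
    |(operatorLayerYOfLetters 𝔸 G x 𝔏 𝔈).Cinv.ker U y y'| ≤
      (cR39 (basis39 𝔸) * Fintype.card (κ39 𝔸)) * (vol (geo9Y x) (d + 1) y')⁻¹ *
        blockKer 𝔬.blk T (repSite39F x.toKIdx bI y) (repSite39F x.toKIdx bI y') := by
  rw [hL39] at hTL hLT
  have hK : ∀ (s : BlkY x.toKIdx) (c : κ39 𝔸) (s' : BlkY x.toKIdx) (c' : κ39 𝔸),
      |entry T (s, c) (s', c')| ≤ blockKer 𝔬.blk T (rep39F x.toKIdx bI s) (rep39F x.toKIdx bI s') := by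
    intro s c s' c'
    have h := abs_entry_le_blockKer 𝔬.blk T (s, c) (s', c')
    rw [hblk] at h ⊢
    exact h
  have hvol : (B9Ineq349SiteComposite.lenB x.toKIdx (β x.hN x.D x.hk y') ^ (d + 1))⁻¹ = (vol (geo9Y x) (d + 1) y')⁻¹ := by
    unfold vol
    rw [B9Ineq349SiteFromBlocks.geo9Y_len_eq_lenB, Real.rpow_natCast]
  have hpt : ∀ E : BallY 𝔸, ‖𝔏.C U (deltaY (β x.hN x.D x.hk y') (E : 𝔸)) (β x.hN x.D x.hk y)‖ ≤
      (cR39 (basis39 𝔸) * Fintype.card (κ39 𝔸)) * (vol (geo9Y x) (d + 1) y')⁻¹ *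
        blockKer 𝔬.blk T (repSite39F x.toKIdx bI y) (repSite39F x.toKIdx bI y') := by
    intro E
    have hE : ‖(E : 𝔸)‖ ≤ 1 := mem_closedBall_zero_iff.1 E.2
    have h := norm_CY_deltaY_le_of_inverse x parA 𝔏.Gp U T hTL hLT (rep39F x.toKIdx bI) (K := fun a a' => blockKer 𝔬.blk T a a') hK
      (β x.hN x.D x.hk y) (β x.hN x.D x.hk y') hE
    rw [hC, ← hvol]
    calc ‖CY x.toKIdx parA 𝔏.Gp U (deltaY (β x.hN x.D x.hk y') (E : 𝔸)) (β x.hN x.D x.hk y)‖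
        ≤ (B9Ineq349SiteComposite.lenB x.toKIdx (β x.hN x.D x.hk y') ^ (d + 1))⁻¹ * (cR39 (basis39 𝔸) * Fintype.card (κ39 𝔸)) *
            blockKer 𝔬.blk T (rep39F x.toKIdx bI (β x.hN x.D x.hk y)) (rep39F x.toKIdx bI (β x.hN x.D x.hk y')) := h
      _ = (cR39 (basis39 𝔸) * Fintype.card (κ39 𝔸)) * (B9Ineq349SiteComposite.lenB x.toKIdx (β x.hN x.D x.hk y') ^ (d + 1))⁻¹ *
            blockKer 𝔬.blk T (repSite39F x.toKIdx bI y) (repSite39F x.toKIdx bI y') := by rw [repSite39F, repSite39F]; ring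
  haveI : Nonempty (BallY 𝔸) := ballY_nonempty
  have hker : (operatorLayerYOfLetters 𝔸 G x 𝔏 𝔈).Cinv.ker U y y' =
      ⨆ E : BallY 𝔸, ‖𝔏.C U (deltaY (β x.hN x.D x.hk y') (E : 𝔸)) (β x.hN x.D x.hk y)‖ := rfl
  rw [hker, abs_of_nonneg (Real.iSup_nonneg fun E => norm_nonneg _)]
  exact ciSup_le hpt

end Reading

/-! ## §2 Rows 15 ∧ 16 at generic `(R₁, R₂, c)` with the averaging transporter explicit -/

section LettersRCPar

open scoped Matrix.Norms.L2Operator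

variable {N : ℕ} (θ : Stage3Params) (Mstar : ℕ) (𝔏 : LettersY N θ Mstar) (𝔈 : ExpsY N θ Mstar)
variable [∀ x : MemberY θ.d₆ θ.ℓ₆ θ.hd' θ.hL' θ.b₀ θ.b₁ Mstar, Fintype (geo9Y x).Site]
  [∀ x : MemberY θ.d₆ θ.ℓ₆ θ.hd' θ.hL' θ.b₀ θ.b₁ Mstar, DecidableEq (geo9Y x).Site]
variable {ι κ : MemberY θ.d₆ θ.ℓ₆ θ.hd' θ.hL' θ.b₀ θ.b₁ Mstar → Type} [∀ x, Fintype (ι x)]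
variable (R₁ R₂ : RegFamY θ.d₆ θ.ℓ₆ θ.hd' θ.hL' θ.b₀ θ.b₁ Mstar (Matrix (Fin N) (Fin N) ℂ))
variable (bI : ∀ x : MemberY θ.d₆ θ.ℓ₆ θ.hd' θ.hL' θ.b₀ θ.b₁ Mstar, FBondY x.toKIdx → IBondY x.toKIdx)
  (parA : ∀ x : MemberY θ.d₆ θ.ℓ₆ θ.hd' θ.hL' θ.b₀ θ.b₁ Mstar, SiteParY (Matrix (Fin N) (Fin N) ℂ) x.toKIdx)

omit [∀ x : MemberY θ.d₆ θ.ℓ₆ θ.hd' θ.hL' θ.b₀ θ.b₁ Mstar, Fintype (geo9Y x).Site] [∀ x, Fintype (ι x)] in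
/-- the carrier-kernel reading for the faithful pins, class-parametric typing, averaging transporter explicit (`kerReadsLeVia_opsYOfLettersR_F` re-pressed).
[cite: Balaban1985BackgroundPropagators, Thm 3.2 (3.48) p.398 + (3.96) p.411 + (3.19) p.393; Balaban1984PropagatorsII, (2.51) p.232 + p.248] -/
theorem kerReadsLeVia_opsYOfLettersR_F_par
    (hC : ∀ x : MemberY θ.d₆ θ.ℓ₆ θ.hd' θ.hL' θ.b₀ θ.b₁ Mstar, (𝔏 x).C = CY x.toKIdx (parA x) (𝔏 x).Gp)
    (𝔬39 : ∀ x : MemberY θ.d₆ θ.ℓ₆ θ.hd' θ.hL' θ.b₀ θ.b₁ Mstar,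
      Ops39Blk (geo9Y x) (bg9YR (Matrix (Fin N) (Fin N) ℂ) (specialUnitaryUnits (Fin N)) R₁ R₂ x) (X39 (Matrix (Fin N) (Fin N) ℂ) x.toKIdx)
        (ι x) (κ x))
    (hblk : ∀ x, (𝔬39 x).blk = blk39F (Matrix (Fin N) (Fin N) ℂ) x.toKIdx (bI x))
    (hL : ∀ x, (𝔬39 x).L = L39 x.toKIdx (parA x) (𝔏 x).Gp) (x : MemberY θ.d₆ θ.ℓ₆ θ.hd' θ.hL' θ.b₀ θ.b₁ Mstar) :
    KerReadsLeVia (𝔬39 x) (siteKernelR R₁ R₂ ((opsYOfLetters N θ Mstar 𝔏 𝔈) x).Cinv) (θ.d₆ + 1)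
      (cR39 (basis39 (Matrix (Fin N) (Fin N) ℂ)) * Fintype.card (κ39 (Matrix (Fin N) (Fin N) ℂ))) (repSite39F x.toKIdx (bI x)) :=
  fun U T hTL hLT y y' =>
    reading_le_of_letters_F_par x (𝔏 x) (𝔈 x) (parA x) (hC x)
      ⟨(𝔬39 x).blk, (𝔬39 x).S, (𝔬39 x).h, (𝔬39 x).chi, (𝔬39 x).L, (𝔬39 x).Lloc, (𝔬39 x).Cl, (𝔬39 x).Sw, (𝔬39 x).Rw⟩
      (hblk x) (hL x) U T hTL hLT y y'

/-- ★★ **ROWS 15 ∧ 16 AT GENERIC LETTERS ON THE FAITHFUL BLOCK MAP, GENERIC `(R₁, R₂, c)`, AVERAGING TRANSPORTER EXPLICIT** —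
`t39_hksum_of_pins_opsYOfLetters_FRC` with the pins `hC : (𝔏 x).C = CY x (parA x) (𝔏 x).Gp`, `hL : (𝔬39 x).L = L39 x (parA x) (𝔏 x).Gp`.
[cite: Balaban1985BackgroundPropagators, Thm 3.9 (3.98)–(3.99) p.413 + Thm 3.2 (3.48) p.398 + (3.25) p.395 + (3.19) p.393 + (3.35) p.396; Balaban1984PropagatorsII, Lemma 2.1 (2.61) p.234 + (2.45) p.231 + (2.51) p.232 + p.248] -/
theorem t39_hksum_of_pins_opsYOfLetters_FRC_par
    (𝔬39 : ∀ x : MemberY θ.d₆ θ.ℓ₆ θ.hd' θ.hL' θ.b₀ θ.b₁ Mstar,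
      Ops39Blk (geo9Y x) (bg9YR (Matrix (Fin N) (Fin N) ℂ) (specialUnitaryUnits (Fin N)) R₁ R₂ x) (X39 (Matrix (Fin N) (Fin N) ℂ) x.toKIdx)
        (ι x) (κ x))
    (rd39 : ∀ x : MemberY θ.d₆ θ.ℓ₆ θ.hd' θ.hL' θ.b₀ θ.b₁ Mstar,
      WalkReading39 (bg9YR (Matrix (Fin N) (Fin N) ℂ) (specialUnitaryUnits (Fin N)) R₁ R₂ x) (ι x) (κ x))
    (c α α' r δ₀ θ₀ B₀ N₀ a₁ M₁ : ℝ) (hc : 0 < c)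
    (hα : 0 < α) (hα1 : α < 1) (hα'0 : 0 < α') (hα'1 : α' < 1) (hr : 0 < r) (hrδ : r ≤ δ₀) (hθ₀ : 0 ≤ θ₀) (hB₀ : 0 < B₀)
    (hN₀ : 0 ≤ N₀) (ha₁ : 0 < a₁) (hM₁ : 0 < M₁)
    (hst : ∀ x, StaticOK39Blk (𝔬39 x) N₀) (hloc : ∀ x, Locality39Blk (𝔬39 x) (rd39 x))
    (h39 : ∀ x : MemberY θ.d₆ θ.ℓ₆ θ.hd' θ.hL' θ.b₀ θ.b₁ Mstar, M₁ ≤ (geo9Y x).M → ∀ α₀ : ℝ, 0 < α₀ → c * (geo9Y x).M * α₀ ≤ a₁ →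
      ∀ U : (bg9YR (Matrix (Fin N) (Fin N) ℂ) (specialUnitaryUnits (Fin N)) R₁ R₂ x).Cfg,
        (bg9YR (Matrix (Fin N) (Fin N) ℂ) (specialUnitaryUnits (Fin N)) R₁ R₂ x).Reg335 c α₀ U →
        Local348Blk (𝔬39 x) B₀ δ₀ U ∧ Identities395Blk (𝔬39 x) U ∧ Small285Blk (𝔬39 x) θ₀ r U ∧ Factors389Blk (𝔬39 x) θ₀ δ₀ U)
    (hC : ∀ x : MemberY θ.d₆ θ.ℓ₆ θ.hd' θ.hL' θ.b₀ θ.b₁ Mstar, (𝔏 x).C = CY x.toKIdx (parA x) (𝔏 x).Gp)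
    (hβI : ∀ (x : MemberY θ.d₆ θ.ℓ₆ θ.hd' θ.hL' θ.b₀ θ.b₁ Mstar) (f : FBondY x.toKIdx) (c : IBondY x.toKIdx),
      blkV1 x.hN x.D f = β x.hN x.D x.hk c → β x.hN x.D x.hk (bI x f) = blkV1 x.hN x.D f)
    (hblk : ∀ x, (𝔬39 x).blk = blk39F (Matrix (Fin N) (Fin N) ℂ) x.toKIdx (bI x))
    (hL : ∀ x, (𝔬39 x).L = L39 x.toKIdx (parA x) (𝔏 x).Gp)
    (hEK39 : ∀ x : MemberY θ.d₆ θ.ℓ₆ θ.hd' θ.hL' θ.b₀ θ.b₁ Mstar, rwKernelExpansionR R₁ R₂ ((opsYOfLetters N θ Mstar 𝔏 𝔈) x).EK39 =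
      EK39OfOpsBlkVia (𝔬39 x) (rd39 x) (θ.d₆ + 1)
        (2 * (N₀ * B₀) * B9RowSum261DefiniteFaces.rowConst261 (geo9Y (d := θ.d₆) (ℓ := θ.ℓ₆) (hd := θ.hd') (hL := θ.hL')
          (b₀ := θ.b₀) (b₁ := θ.b₁) (Mstar := Mstar)) (α' * r)) ((1 - α') * r) (repSite39F x.toKIdx (bI x))) :
    B9.Thm39Printed (θ.d₆ + 1) c geo9Y (bg9YR (Matrix (Fin N) (Fin N) ℂ) (specialUnitaryUnits (Fin N)) R₁ R₂)
        (fun x => rwKernelExpansionR R₁ R₂ ((opsYOfLetters N θ Mstar 𝔏 𝔈) x).EK39) ∧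
      B9.RWKernelSumYields (θ.d₆ + 1) geo9Y (bg9YR (Matrix (Fin N) (Fin N) ℂ) (specialUnitaryUnits (Fin N)) R₁ R₂)
        (fun x => rwKernelExpansionR R₁ R₂ ((opsYOfLetters N θ Mstar 𝔏 𝔈) x).EK39)
        (fun x => siteKernelR R₁ R₂ ((opsYOfLetters N θ Mstar 𝔏 𝔈) x).Cinv) :=
  thm39_and_kernelSum_of_pin_rowConst261BlkViaDatum 𝔬39 rd39 (fun x => siteKernelR R₁ R₂ ((opsYOfLetters N θ Mstar 𝔏 𝔈) x).Cinv)
    (θ.d₆ + 1) (fun x => repSite39F x.toKIdx (bI x)) α α' r δ₀ θ₀ B₀ N₀ a₁ M₁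
    (cR39 (basis39 (Matrix (Fin N) (Fin N) ℂ)) * Fintype.card (κ39 (Matrix (Fin N) (Fin N) ℂ))) hc hα hα1 hα'0 hα'1 hr hrδ hθ₀ hB₀ hN₀
    ha₁ hM₁ (mul_nonneg (cR39_nonneg _) (Nat.cast_nonneg _)) hst hloc rowSum261_geo9Y (fun x y => len_repSite39F (hβI x) y)
    (fun x y z => dist_repSite39F_left (hβI x) y z) (fun x z y => dist_repSite39F_right (hβI x) z y)
    (kerReadsLeVia_opsYOfLettersR_F_par θ Mstar 𝔏 𝔈 R₁ R₂ bI parA hC 𝔬39 hblk hL) h39 hEK39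

omit [∀ x, Fintype (ι x)] in
/-- ★★★ **ROWS 15 ∧ 16 AT GENERIC `(R₁, R₂, c)` FROM ONE DISPLAY ON THE FAITHFUL ONE-CUBE LETTERS WITH THE AVERAGING TRANSPORTER EXPLICIT** —
`t39_hksum_oneCube_opsYOfLetters_FRC` over the one-cube ops `oneCubeOps39 (geo9Y x) (bg9YR … x) (blk39F _ x.toKIdx (bI x)) (L39 x.toKIdx (parA x) (𝔏 x).Gp)`:
from the display `h348` (the genuine `L = Q′(parA)G′²Q′*(parA)` has a two-sided inverse with block majorant `B₀(Lʲη)⁻⁴e^{−δ₀d}`), the letter coherence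
`hC : (𝔏 x).C = CY x (parA x) (𝔏 x).Gp`, n06-i's binder `hβI` and the `𝔈`-pin `hEK39`, the two leaves at class constant `c`.  The knit certificate's instance:
`parA := fun x => parKnitY x.toKIdx` at letters with `(𝔏 x).Gp = GpY x (parKnitY x)`, `(𝔏 x).C = CY x (parKnitY x) (GpY x (parKnitY x))`.
[cite: Balaban1985BackgroundPropagators, Thm 3.9 (3.98)–(3.99) p.413 + Thm 3.2 (3.48) p.398 + (3.95)–(3.96) p.411 + (3.19) p.393 + (3.35) p.396 («c a number ≧ 10»); Balaban1985Averaging, Prop. 2 p.26; Balaban1984PropagatorsII, (2.45) p.231 + (2.51) p.232 + Lemma 2.1 (2.61) p.234 + p.248] -/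
theorem t39_hksum_oneCube_opsYOfLetters_FRC_par (c α' r B₀ δ₀ a₁ M₁ : ℝ) (hc : 0 < c)
    (hα'0 : 0 < α') (hα'1 : α' < 1) (hr : 0 < r) (hrδ : r ≤ δ₀) (hB₀ : 0 < B₀) (ha₁ : 0 < a₁) (hM₁ : 0 < M₁)
    (h348 : ∀ x : MemberY θ.d₆ θ.ℓ₆ θ.hd' θ.hL' θ.b₀ θ.b₁ Mstar, M₁ ≤ (geo9Y x).M → ∀ α₀ : ℝ, 0 < α₀ → c * (geo9Y x).M * α₀ ≤ a₁ →
      ∀ U : (bg9YR (Matrix (Fin N) (Fin N) ℂ) (specialUnitaryUnits (Fin N)) R₁ R₂ x).Cfg,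
        (bg9YR (Matrix (Fin N) (Fin N) ℂ) (specialUnitaryUnits (Fin N)) R₁ R₂ x).Reg335 c α₀ U →
          Conv348Blk (oneCubeOps39 (geo9Y x) (bg9YR (Matrix (Fin N) (Fin N) ℂ) (specialUnitaryUnits (Fin N)) R₁ R₂ x)
            (blk39F (Matrix (Fin N) (Fin N) ℂ) x.toKIdx (bI x)) (L39 x.toKIdx (parA x) (𝔏 x).Gp)) B₀ δ₀ U)
    (hC : ∀ x : MemberY θ.d₆ θ.ℓ₆ θ.hd' θ.hL' θ.b₀ θ.b₁ Mstar, (𝔏 x).C = CY x.toKIdx (parA x) (𝔏 x).Gp)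
    (hβI : ∀ (x : MemberY θ.d₆ θ.ℓ₆ θ.hd' θ.hL' θ.b₀ θ.b₁ Mstar) (f : FBondY x.toKIdx) (c : IBondY x.toKIdx),
      blkV1 x.hN x.D f = β x.hN x.D x.hk c → β x.hN x.D x.hk (bI x f) = blkV1 x.hN x.D f)
    (hEK39 : ∀ x : MemberY θ.d₆ θ.ℓ₆ θ.hd' θ.hL' θ.b₀ θ.b₁ Mstar,
      rwKernelExpansionR R₁ R₂ ((opsYOfLetters N θ Mstar 𝔏 𝔈) x).EK39 =
      EK39OfOpsBlkVia (oneCubeOps39 (geo9Y x) (bg9YR (Matrix (Fin N) (Fin N) ℂ) (specialUnitaryUnits (Fin N)) R₁ R₂ x)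
          (blk39F (Matrix (Fin N) (Fin N) ℂ) x.toKIdx (bI x)) (L39 x.toKIdx (parA x) (𝔏 x).Gp)) (oneCubeReading39 _) (θ.d₆ + 1)
        (2 * (1 * B₀) * B9RowSum261DefiniteFaces.rowConst261 (geo9Y (d := θ.d₆) (ℓ := θ.ℓ₆) (hd := θ.hd') (hL := θ.hL')
          (b₀ := θ.b₀) (b₁ := θ.b₁) (Mstar := Mstar)) (α' * r)) ((1 - α') * r) (repSite39F x.toKIdx (bI x))) :
    B9.Thm39Printed (θ.d₆ + 1) c geo9Y (bg9YR (Matrix (Fin N) (Fin N) ℂ) (specialUnitaryUnits (Fin N)) R₁ R₂)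
        (fun x => rwKernelExpansionR R₁ R₂ ((opsYOfLetters N θ Mstar 𝔏 𝔈) x).EK39) ∧
      B9.RWKernelSumYields (θ.d₆ + 1) geo9Y (bg9YR (Matrix (Fin N) (Fin N) ℂ) (specialUnitaryUnits (Fin N)) R₁ R₂)
        (fun x => rwKernelExpansionR R₁ R₂ ((opsYOfLetters N θ Mstar 𝔏 𝔈) x).EK39)
        (fun x => siteKernelR R₁ R₂ ((opsYOfLetters N θ Mstar 𝔏 𝔈) x).Cinv) :=
  t39_hksum_of_pins_opsYOfLetters_FRC_par θ Mstar 𝔏 𝔈 R₁ R₂ bI parA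
    (fun x => oneCubeOps39 (geo9Y x) (bg9YR (Matrix (Fin N) (Fin N) ℂ) (specialUnitaryUnits (Fin N)) R₁ R₂ x)
      (blk39F (Matrix (Fin N) (Fin N) ℂ) x.toKIdx (bI x)) (L39 x.toKIdx (parA x) (𝔏 x).Gp)) (fun _ => oneCubeReading39 _)
    c (1 / 2) α' r δ₀ 0 B₀ 1 a₁ M₁ hc one_half_pos one_half_lt_one hα'0 hα'1 hr hrδ le_rfl hB₀ zero_le_one ha₁ hM₁
    (fun x => staticOK39Blk_oneCube _ _ (geo9Y_dist_triangle x) (geo9Y_dist_self x) (geo9K_dist_nonneg' x.toKIdx) (geo9Y_len_pos x))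
    (fun _ => locality39Blk_oneCube _ _)
    (fun x hM α₀ hα ha U hU => schemas39_oneCube_of_conv348 _ _ r le_rfl (geo9Y_M_nonneg θ Mstar x) (h348 x hM α₀ hα ha U hU))
    hC hβI (fun _ => rfl) (fun _ => rfl) hEK39

end LettersRCPar

end Literature.MathematicalPhysics.QuantumFieldTheory.Balaban1983to89.B9Thm39FacesAtLettersRCPar

end
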